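import Mathlib
import Summits.MatrixMultiplication.Statement
import Summits.MatrixMultiplication.MatrixMultiplication.Theorems.GraphEquationsExactMembers
import Summits.MatrixMultiplication.MatrixMultiplication.Theorems.GraphEquationsAffineDeflation
import Summits.MatrixMultiplication.MatrixMultiplication.Theorems.GraphEquationsJetTruncation

/-!
# Graph equations — THE SERVE ENGINE (M20b, decomp-mm-lens-5 g33)

(supports `MultiplicityReduction`, stmt-MatrixMultiplication-27806; the common core beneath the exact
engines M19i/M19m/M19p/M19r.  No new definition.)

**What every rank rung of the membership ladder actually reads.**  Let `p_o` be polynomials in the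
cost-free span of ONE nonscalar sequence of length `≤ N` (the outputs of a program).  If for every
position `q` some CONSTANT combination `Σ_o P_{q,o} p_o` equals `f_q + r_q` with a remainder `r_q`
having NO `a ⊗ b` COEFFICIENTS (anything else — constants, linear terms, `c`-terms, `a⊗a`, `a⊗c`,
cubics … — is allowed), then `R(⟨n,n,n⟩) ≤ 2N` (`tensorRank_le_of_abServed`): the `a⊗b`-block of a
computed polynomial is a sum of `≤ 2N` triads (`exists_triads_of_isNonscalarSeq`, BCS (14.8)), and the
`a⊗b`-block of `f_q` is `-(ab)_q`.  No vanishing on the graph, no flatness (V0/V1), no certificates,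
no correctness are needed — those hypotheses of the exact engines are just one way of PRODUCING served
combinations (an exact unit member `Σ h_o p_o = u f_q` with V0/V1-flat `p_o` is served by
`P_o = h_o(0)/u(0)`).

**The program.**  Forward-mode AD along a LIST `Ξ` of cost-free affine fields, staged, puts every
iterated derivative `D_{ξ_{i_s}} ⋯ D_{ξ_{i_1}} p` along a sub-word of `Ξ` into the span of a nonscalar
sequence of length `≤ 3^{|Ξ|}·N` (`IsNonscalarSeq.derivC_affine_list`, from M19's `derivC_affine`).
Hence (`tensorRank_le_of_servedWords`, `EqSystem.tensorRank_le_of_servedAt`): if at some base `y` the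
translated tests of ANY fan-in-two system `E` and their word-derivatives along `Ξ` serve every `f_q`
modulo `a⊗b`-free remainders, then `R(⟨n,n,n⟩) ≤ 2·3^{|Ξ|}·cost E`.

**Why this is the right currency for the rungs `e ≥ 3`** (NODE-g33 §2).  The level-`2` residual typed
in g32 (chain data with V0/V1 on every selected output and `ℂ[a,b]`-unit cube certificates) is FALSE
at `n = 2` by ENTANGLEMENT (`t₂ = f̃₁₂³ + t₁`, `t₂ = f̃₁₂³ + a₁₁·t₁` next to the dirty
`t₁ = f̃₁₁ + β f̃₁₂ + f̃₁₂²`), yet both systems are SERVED by words of length `≤ 2` in three fields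
(`(1/6)·D₁₂D₁₂ t₂ - (1/3)·D₁₁ t₂ = f̃₁₂` exactly): the flatness demands were artefacts of the
certificate bookkeeping, not of the rank reading.
-/

set_option linter.dupNamespace false

noncomputable section

open scoped BigOperators

namespace Summit.MatrixMultiplication.MatrixMultiplication.Theorems.GraphEquations

open MvPolynomial
open Literature.Computability.AlgebraicComplexity
open Literature.Computability.AlgebraicComplexity.ArithCircuit

variable {n : ℕ}

/-! ## The system-free core: served modulo `a⊗b`-free remainders -/

/-- The `a_{ij} b_{j'l}`-coefficient of the generator `f_q`: `-[j = j'][q = (i,l)]`. -/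
theorem coeff_ab_generator (q : Fin n × Fin n) (i j j' l : Fin n) :
    coeff (Finsupp.single (Sum.inl (Sum.inl (i, j)) : GraphVars n) 1 +
        Finsupp.single (Sum.inl (Sum.inr (j', l)) : GraphVars n) 1) (generator n q) =
      -(if j = j' then (if q = (i, l) then (1 : ℂ) else 0) else 0) := by
  rw [coeffIdentity n (generator n q) (fun x hx => eval_generator_of_mem hx q) i j j' l,
    coeff_inr_generator]

/-- **THE SERVE ENGINE (system-free core).**  Outputs `p_o` in the cost-free span of a nonscalar
sequence of length `≤ N`; for every `q` a CONSTANT combination `Σ_o P_{q,o}·p_o = f_q + r_q` whose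
remainder has no `a⊗b` coefficients.  Then `R(⟨n,n,n⟩) ≤ 2N`. -/
theorem tensorRank_le_of_abServed {N : ℕ} {ο : Type*} [Fintype ο] [DecidableEq ο]
    (p : ο → MvPolynomial (GraphVars n) ℂ)
    (hspan : ∃ gs : List (MvPolynomial (GraphVars n) ℂ), IsNonscalarSeq gs ∧ gs.length ≤ N ∧
      ∀ o, p o ∈ freeSpan {q | q ∈ gs})
    (P : Fin n × Fin n → ο → ℂ) (r : Fin n × Fin n → MvPolynomial (GraphVars n) ℂ)
    (hrab : ∀ (q : Fin n × Fin n) (i j j' l : Fin n),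
      coeff (Finsupp.single (Sum.inl (Sum.inl (i, j)) : GraphVars n) 1 +
        Finsupp.single (Sum.inl (Sum.inr (j', l)) : GraphVars n) 1) (r q) = 0)
    (hserve : ∀ q, ∑ o, C (P q o) * p o = generator n q + r q) :
    tensorRank (matMulTensor ℂ n n n) ≤ 2 * N := by
  classical
  obtain ⟨ρ, hρ, w, u, v, hwuv⟩ := exists_triads_of_isNonscalarSeq
    (fun a : Fin n × Fin n => (Sum.inl (Sum.inl a) : GraphVars n))
    (fun b : Fin n × Fin n => (Sum.inl (Sum.inr b) : GraphVars n))
    (fun a b h => by simp at h) p hspan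
  refine le_trans (tensorRank_le_of_eq_sum (fun τ c => -∑ o, P c o * w τ o) u v ?_) hρ
  funext c a b
  obtain ⟨i, j⟩ := a
  obtain ⟨j', l⟩ := b
  -- the `a_{ij} b_{j'l}`-coefficient of the served identity
  have hab : ∑ o, P c o * coeff (Finsupp.single (Sum.inl (Sum.inl (i, j)) : GraphVars n) 1 +
        Finsupp.single (Sum.inl (Sum.inr (j', l)) : GraphVars n) 1) (p o) =
      -(if j = j' then (if c = (i, l) then (1 : ℂ) else 0) else 0) := by
    have := congrArg (coeff (Finsupp.single (Sum.inl (Sum.inl (i, j)) : GraphVars n) 1 +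
      Finsupp.single (Sum.inl (Sum.inr (j', l)) : GraphVars n) 1)) (hserve c)
    simpa only [coeff_sum, coeff_C_mul, coeff_add, hrab, add_zero, coeff_ab_generator] using this
  have hsum : (∑ τ, triad (fun c => -∑ o, P c o * w τ o) (u τ) (v τ)) c (i, j) (j', l) =
      -∑ o, P c o * ∑ τ, w τ o * u τ (i, j) * v τ (j', l) := by
    simp only [Finset.sum_apply, triad_apply, neg_mul, Finset.sum_neg_distrib, Finset.sum_mul,
      Finset.mul_sum]
    rw [Finset.sum_comm]
    congr 1
    refine Finset.sum_congr rfl fun o _ => Finset.sum_congr rfl fun τ _ => by ring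
  rw [hsum]
  simp_rw [hwuv]
  rw [hab, neg_neg]
  obtain ⟨c1, c2⟩ := c
  by_cases hjj : j = j'
  · subst hjj
    by_cases hc : (c1, c2) = (i, l)
    · obtain ⟨rfl, rfl⟩ := Prod.mk.inj hc
      simp [matMulTensor]
    · have hc' : ¬(c1 = i ∧ c2 = l) := fun h => hc (by rw [h.1, h.2])
      simp only [matMulTensor, if_true, hc, if_false]
      rw [if_neg]
      rintro ⟨h1, -, h3⟩
      exact hc' ⟨h1, h3⟩
  · simp [matMulTensor, hjj]

/-! ## Forward AD along a list of affine fields -/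

/-- **Staged AD closure along a LIST of cost-free affine fields, at length `× 3^{|Ξ|}`.**  Every
iterated derivative of a free element along a SUB-WORD of `Ξ` (fields applied in the order of `Ξ`)
is free over the new sequence. -/
theorem IsNonscalarSeq.derivC_affine_list :
    ∀ (Ξ : List (Fin n × Fin n → MvPolynomial (MatMulVars n) ℂ)),
      (∀ ξ ∈ Ξ, ∀ q, liftAB n (ξ q) ∈ freeSpan (∅ : Set (MvPolynomial (GraphVars n) ℂ))) →
      ∀ {gs : List (MvPolynomial (GraphVars n) ℂ)}, IsNonscalarSeq gs →
        ∃ gs' : List (MvPolynomial (GraphVars n) ℂ), IsNonscalarSeq gs' ∧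
          gs'.length ≤ 3 ^ Ξ.length * gs.length ∧
          ∀ p ∈ freeSpan {x | x ∈ gs}, ∀ L : List (Fin n × Fin n → MvPolynomial (MatMulVars n) ℂ),
            L.Sublist Ξ → L.foldl (fun acc ξ => derivC ξ acc) p ∈ freeSpan {x | x ∈ gs'}
  | [], _, gs, hgs => by
    refine ⟨gs, hgs, by simp, fun p hp L hL => ?_⟩
    rw [List.sublist_nil.mp hL]
    simpa using hp
  | ξ :: Ξ, hΞ, gs, hgs => by
    obtain ⟨gs₁, hns₁, hlen₁, hsub₁, hD₁⟩ :=
      IsNonscalarSeq.derivC_affine ξ (hΞ ξ (List.mem_cons_self)) hgs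
    obtain ⟨gs', hns', hlen', hW⟩ :=
      IsNonscalarSeq.derivC_affine_list Ξ (fun ζ hζ => hΞ ζ (List.mem_cons_of_mem _ hζ)) hns₁
    refine ⟨gs', hns', ?_, fun p hp L hL => ?_⟩
    · calc gs'.length ≤ 3 ^ Ξ.length * gs₁.length := hlen'
        _ ≤ 3 ^ Ξ.length * (3 * gs.length) := Nat.mul_le_mul_left _ hlen₁
        _ = 3 ^ (ξ :: Ξ).length * gs.length := by rw [List.length_cons, pow_succ]; ring
    · rcases hL with _ | ⟨_, hL'⟩ | ⟨_, hL'⟩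
      · exact hW p (hsub₁ p hp) L hL'
      · rw [List.foldl_cons]
        exact hW (derivC ξ p) (hD₁ p hp) _ hL'

/-- **THE SERVE ENGINE, word form.**  Outputs `t_o` free over a nonscalar sequence of length `≤ N`,
a list `Ξ` of cost-free affine fields; if for every `q` a constant combination of the word-derivatives
`D_L t_o` (`L` a sub-word of `Ξ`) equals `f_q + r_q` with `r_q` free of `a⊗b` coefficients, then
`R(⟨n,n,n⟩) ≤ 2·3^{|Ξ|}·N`. -/
theorem tensorRank_le_of_servedWords {N T : ℕ} (t : Fin T → MvPolynomial (GraphVars n) ℂ)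
    (hspan : ∃ gs : List (MvPolynomial (GraphVars n) ℂ), IsNonscalarSeq gs ∧ gs.length ≤ N ∧
      ∀ o, t o ∈ freeSpan {q | q ∈ gs})
    (Ξ : List (Fin n × Fin n → MvPolynomial (MatMulVars n) ℂ))
    (hΞ : ∀ ξ ∈ Ξ, ∀ q, liftAB n (ξ q) ∈ freeSpan (∅ : Set (MvPolynomial (GraphVars n) ℂ)))
    (hserve : ∀ q : Fin n × Fin n,
      ∃ (P : Fin T → Fin Ξ.sublists.length → ℂ) (r : MvPolynomial (GraphVars n) ℂ),
        (∀ i j j' l : Fin n,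
          coeff (Finsupp.single (Sum.inl (Sum.inl (i, j)) : GraphVars n) 1 +
            Finsupp.single (Sum.inl (Sum.inr (j', l)) : GraphVars n) 1) r = 0) ∧
        ∑ o, ∑ s, C (P o s) * (Ξ.sublists.get s).foldl (fun acc ξ => derivC ξ acc) (t o) =
          generator n q + r) :
    tensorRank (matMulTensor ℂ n n n) ≤ 2 * (3 ^ Ξ.length * N) := by
  classical
  obtain ⟨gs, hns, hlen, ht⟩ := hspan
  obtain ⟨gs', hns', hlen', hW⟩ := IsNonscalarSeq.derivC_affine_list Ξ hΞ hns
  choose P r hrab hPr using hserve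
  refine tensorRank_le_of_abServed
    (fun os : Fin T × Fin Ξ.sublists.length =>
      (Ξ.sublists.get os.2).foldl (fun acc ξ => derivC ξ acc) (t os.1))
    ⟨gs', hns', hlen'.trans (Nat.mul_le_mul_left _ hlen), fun os =>
      hW (t os.1) (ht os.1) _ (List.mem_sublists.mp (List.get_mem _ _))⟩
    (fun q os => P q os.1 os.2) r hrab fun q => ?_
  rw [← hPr q, Fintype.sum_prod_type]

/-- **THE SERVE ENGINE for a system at a base.**  For ANY fan-in-two system `E` (correctness is not
used), any base `y` and any list `Ξ` of cost-free affine fields: if the translated tests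
`τ_y t_o` and their word-derivatives along `Ξ` serve every generator modulo `a⊗b`-free remainders,
then `R(⟨n,n,n⟩) ≤ 2·3^{|Ξ|}·cost E`. -/
theorem EqSystem.tensorRank_le_of_servedAt {E : EqSystem n} (hfan : E.circuit.IsFanInTwo)
    (y : MatMulVars n → ℂ) (Ξ : List (Fin n × Fin n → MvPolynomial (MatMulVars n) ℂ))
    (hΞ : ∀ ξ ∈ Ξ, ∀ q, liftAB n (ξ q) ∈ freeSpan (∅ : Set (MvPolynomial (GraphVars n) ℂ)))
    (hserve : ∀ q : Fin n × Fin n,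
      ∃ (P : Fin E.tests.length → Fin Ξ.sublists.length → ℂ) (r : MvPolynomial (GraphVars n) ℂ),
        (∀ i j j' l : Fin n,
          coeff (Finsupp.single (Sum.inl (Sum.inl (i, j)) : GraphVars n) 1 +
            Finsupp.single (Sum.inl (Sum.inr (j', l)) : GraphVars n) 1) r = 0) ∧
        ∑ o, ∑ s, C (P o s) * (Ξ.sublists.get s).foldl (fun acc ξ => derivC ξ acc)
            (translate y (E.testPoly (E.tests.get o))) = generator n q + r) :
    tensorRank (matMulTensor ℂ n n n) ≤ 2 * (3 ^ Ξ.length * E.cost) :=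
  tensorRank_le_of_servedWords (fun o => translate y (E.testPoly (E.tests.get o)))
    (exists_isNonscalarSeq_translate hfan y) Ξ hΞ hserve

/-- **The level-0 instance** (`Ξ = []`): tests serving the generators modulo `a⊗b`-free remainders at a
base give `R(⟨n,n,n⟩) ≤ 2·cost` — e.g. a generator system, or any system whose tests are
`f_q +` (terms without `a⊗b` coefficients at `y`). -/
theorem EqSystem.tensorRank_le_of_servedAt_nil {E : EqSystem n} (hfan : E.circuit.IsFanInTwo)
    (y : MatMulVars n → ℂ)
    (hserve : ∀ q : Fin n × Fin n,
      ∃ (P : Fin E.tests.length → ℂ) (r : MvPolynomial (GraphVars n) ℂ),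
        (∀ i j j' l : Fin n,
          coeff (Finsupp.single (Sum.inl (Sum.inl (i, j)) : GraphVars n) 1 +
            Finsupp.single (Sum.inl (Sum.inr (j', l)) : GraphVars n) 1) r = 0) ∧
        ∑ o, C (P o) * translate y (E.testPoly (E.tests.get o)) = generator n q + r) :
    tensorRank (matMulTensor ℂ n n n) ≤ 2 * E.cost := by
  classical
  choose P r hrab hPr using hserve
  exact tensorRank_le_of_abServed (fun o => translate y (E.testPoly (E.tests.get o)))
    (exists_isNonscalarSeq_translate hfan y) P r hrab hPr

end Summit.MatrixMultiplication.MatrixMultiplication.Theorems.GraphEquations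

end
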